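import Summits.QuantumFields.BalabanUV.Beta.FP.RoadLeftLiteralSRecord
import Summits.QuantumFields.BalabanUV.Beta.FP.LegShiftDictionaryBlocks

/-!
# `BalabanUV.Beta.FP.RoadLeftLiteralStraight` — road «FP» for binder row D1: THE TERMINAL END AT THE LITERAL WITH THE GLUON BLOCK AND THE SLICE∕LEDGER BLOCK
# RE-DISPLAYED STRAIGHT (`RESIDUAL-FP` ROW #22 «LEG CONVENTION», RULING R-FP-42 (4e); owner INTENT journal 2026-08-21T10:55Z, «MINE» leaf-06 g12)

HONEST DEPENDENCY (page 1, mandatory): continuum YM on T⁴ ⇐ BetaPertH ∧ nine spine estimates (0/9 proved); BetaPertH ⇐ (D1) ∧ (D4) ∧ CAP+tail;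
G-an2-4 gates asym, D1 and NE2/3/4.  HONEST FRAMING (cell contract, verbatim): «discharging `BetaPertH` makes Bałaban's UV stability UNCONDITIONAL —
a real constructive-QFT result; it is NOT the continuum limit and NOT the Clay problem.»  THIS MODULE is [our object] COMPOSITION BY NAME (one chain link
downstream of `RoadLeftLiteralSRecord` — this lineage g11 — through the road-FP OWNER's two dictionaries `LegShiftDictionary` ∕ `LegShiftDictionaryBlocks`, d1-p3 g11);
no `def`, no `def … : Prop`, nothing cited, 0 sorry.  R-FP-42 OF RECORD: «ROW #22 RESOLVES BY DICTIONARY, NOT BY RE-DISPLAY … literal-side suppliers state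
gluon-sector instances STRAIGHT (leg `Pkerˢˢ`) … then ONE additive literal-chain link re-displaying the gluon block and `hslice`'s leg at `Pkerˢˢ`».
WHAT CHANGES vs `d1Drift_JsB12Sym_of_sliceLedger_ghost_Srec` (ZERO new hypotheses; every other binder VERBATIM, transcribed from the tree bytes by script): the gluon block
`V W X hV hW hcovV hcovW hX hW1 hW2 hKcov h0V hgermV hWloc` and the slice∕ledger block `R Ssl Wsl hRb hSsl hWsl hslice hL0 … hL6` now denote STRAIGHT data —
`hW1 : (Pkerˢˢ ∘ divV V y) ∘ Pkerˢˢ = Pkerˢˢ ∘ X y − X y ∘ Pkerˢˢ`, `hKcov : AxisReflectionCovariant (flipK (μ ν z ↦ wg·hessKer Pkerˢˢ V W μ ν z − wgh·hessKer G0ker ghCur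
(diagExt (−ghX)) μ ν z))`, `hslice`'s leg `c m • blk Pkerˢˢ tt + R m`, and `Pkerˢˢ` for `Pker` in the words of `hL1 hL2 hL4 hL5 hL6` (`Pkerˢˢ` := the lambda
`fun x z a b => Pker z x a b`, R12's spelling).  PROOF: the SRecord END at `(Ψ·V, Ψ·W, Ψ·X, Ψ′·R, Ψ′·Ssl, Ψ′·Wsl)` (`Ψ` = `exists_legShift`, `Ψ′` = `exists_legShift₄`)
with `Cv Cw Cx CwL ↦ ·e^{2δ}`; transported letters: `biLoc_refK_legShift` (`hV hW hX hWloc`), `cov(₂)_refK_legShift` (`hcovV hcovW`), `hW1_legShift`, `hW2_legShift`,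
`h0V_legShift`, `cubicGermOf_legShift_of_h0` (`hgermV`), `funext`+`PiBF_legShift` (`hKcov`); `bdd_refK`∕`biLoc_refK_legShift₄` (`hRb hSsl hWsl`); `hslice` by
`sliceLeg_legShift₄` + `tadpole_refK_bdd`∕`bubble_refK_bdd`; the ledger lines `hL0`–`hL6` by the pointwise word identities (`tadpole_refK_bdd`, `mixedBubble_refK_bdd`,
`bubble_refK_bdd`, `defectJet_legShift₄`, `blk_tt_refK`) rewritten under the window `if`.  AFTER THIS LINK the chain of record reads
`_rows → _rows_letters → RowsLetters → Ghost → SRecord → Straight` and every supplier of the gluon∕slice∕ledger instances states STRAIGHT.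
STILL DISPLAYED: the W-family `Wt` + `hWt1` + X1m-W rows, `hWj`, `hSDF` (the shared crux), the W-split letters, PART 3b, `hslice`, `hKcov`, the (ASYMP)-side data.
0∕4 row-D1 binders; NOT (Kcov), NOT (CONV-C), NOT X1, NOT hWj, NOT SDF, NOT hslice, NOT (ASYMP), NOT D1, NOT BetaPertH, NOT continuum, NOT Clay.  «not in print;
our bookkeeping».
ABSOLUTE RULE (cell charter, verbatim): «No internally-minted statement may enter as a cited fact. Every hypothesis is either kernel-proved in this package or a
verbatim quotation of a PUBLISHED theorem with page reference. The manuscript(s) under audit are NOT citable for their own disputed steps — they are the thing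
under adjudication; programme-internal (2001/route/tribunal) claims are never citable.»
CONTENT: [our object] **`d1Drift_JsB12Sym_of_sliceLedger_straight`** — conclusion `D1Drift Lc (JsB12Sym hOdd Ncol tabs cΛ cB) N μ ν`.
Provenance: D1 formalisation swarm LEAF PROVER 06, unit b2b-balaban-beta-d1-formalise-leaf-06 gen 12, 2026-08-21 (owner INTENT l.30563, «MINE» l.30579).
-/

noncomputable section

namespace Summit.QuantumFields.BalabanUV.Beta.FP.RoadLeftLiteralStraight

open Finset
open scoped BigOperators
open Literature.MathematicalPhysics.QuantumFieldTheory.Balaban1983to89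
open Literature.MathematicalPhysics.QuantumFieldTheory.Balaban1983to89.Beta
open Literature.MathematicalPhysics.QuantumFieldTheory.Balaban1983to89.Beta.BubbleTransfer (c4)
open B12Sec2to5 (l1)
open PolarizationSign (AxisReflectionCovariant WardTransversal)
open ExpKernelCalculus (Site MKer BiLoc comp shiftK tr tadpole bubble hessKer VertexFamily₂)
open KernelWard (Bdd divV divW biLoc_sub)
open KernelReflection (LegMap refK)
open StepJetData (biLoc_smul)
open OneStepResolventKernel (Fib LocStencil)
open OneStepKernelFamily (flipK colH vertexOfK D1Drift TbalOf)
open DyadicShell (Pt supNorm)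
open LeadingCoefficient (kappaBal)
open SecondOrderResponse (vertex2OfK)
open DressedMomentNormalisation (dressedEntry)
open Summit.QuantumFields.BalabanUV.Beta.SymmetrisedStepJets
open Summit.QuantumFields.BalabanUV.Beta.HessKerDressedUnits (unitS unitW)
open Summit.QuantumFields.BalabanUV.Beta.GAN24.CombesThomas (sfStep smStep)
open Summit.QuantumFields.BalabanUV.Beta.D1BFx.MomentTransferPeriodicEntry (EKer₂ dressedEntryP)
open Summit.QuantumFields.BalabanUV.Beta.D1BFx.ReducedKernelSandwichLeg (fineHessA)
open Summit.QuantumFields.BalabanUV.Beta.D1BFx.PackedKernelSplit (blk biLoc_blk)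
open Summit.QuantumFields.BalabanUV.Beta.D1BFx.GhostStencil (ghCur)
open Summit.QuantumFields.BalabanUV.Beta.D1BFx.ReducedKernelSandwichBlock (diagExt)
open Summit.QuantumFields.BalabanUV.Beta.D1BFx.GhostStencilReflection (ghX refK_smul)
open Summit.QuantumFields.BalabanUV.Beta.FP.PerfectObjectsT (KPerf SPerfOf WPerfOf)
open Summit.QuantumFields.BalabanUV.Beta.FP.TransportInfinityM (colOf)
open Summit.QuantumFields.BalabanUV.Beta.FP.StepDefectInherit (defect)
open Summit.QuantumFields.BalabanUV.Beta.FP.WilsonCubicGerm (cubicGermOf)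
open Summit.QuantumFields.BalabanUV.Beta.FP.BubbleGermValue (bfGerm)
open Summit.QuantumFields.BalabanUV.Beta.FP.PerfectPolarization (Pker G0ker PiBF)
open Summit.QuantumFields.BalabanUV.Beta.FP.PerfectPropagatorLegData (A0P)
open Summit.QuantumFields.BalabanUV.Beta.FP.PerfectLegSwapReflection (bdd_PkerSwap)
open Summit.QuantumFields.BalabanUV.Beta.FP.FineHessianGluonCore (bdd_smul)
open Summit.QuantumFields.BalabanUV.Beta.FP.FineHessianNearLedgerCore (bdd_blk)
open Summit.QuantumFields.BalabanUV.Beta.FP.KernelReflectionBounded (tadpole_refK_bdd bubble_refK_bdd)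
open Summit.QuantumFields.BalabanUV.Beta.FP.LegShiftDictionary (exists_legShift biLoc_refK_legShift cov_refK_legShift cov₂_refK_legShift hW1_legShift
  hW2_legShift h0V_legShift cubicGermOf_legShift_of_h0 PiBF_legShift)
open Summit.QuantumFields.BalabanUV.Beta.FP.LegShiftDictionaryBlocks (exists_legShift₄ bdd_refK biLoc_refK_legShift₄ blk_tt_refK refK_legShift₄_blk_PkerSwap
  sliceLeg_legShift₄ defectJet_legShift₄ bdd_smul_add mixedBubble_refK_bdd)
open Summit.QuantumFields.BalabanUV.Beta.FP.RoadLeftLiteralSRecord (d1Drift_JsB12Sym_of_sliceLedger_ghost_Srec)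

variable {Lc : ℕ} [NeZero Lc]

/-- **ROAD «FP» — THE TERMINAL END AT THE LITERAL, GLUON AND SLICE∕LEDGER BLOCKS STRAIGHT** [our object]: `RoadLeftLiteralSRecord.d1Drift_JsB12Sym_of_sliceLedger_ghost_Srec`
with the gluon-sector letters, (Kcov), `hslice`'s leg and the gluon-core ledger words read at the STRAIGHT leg `Pkerˢˢ := fun x z a b => Pker z x a b`
(R-FP-42); zero new hypotheses; everything else verbatim.  CONCLUSION: `D1Drift Lc (JsB12Sym hOdd Ncol tabs cΛ cB) N μ ν`. -/
theorem d1Drift_JsB12Sym_of_sliceLedger_straight (hLc : 2 ≤ Lc) (hOdd : Odd Lc) (Ncol : ℕ) (tabs : SymTables 3 Lc) (cΛ cB : ℝ)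
    -- the (j, m)-families of the literal's stencils ∕ second-order tables, pinned at m = 1
    -- R-FP-41: the S-family of record is `S j m := (JsB12Sym hOdd Ncol tabs cΛ cB j).S` (m-independent) — PINNED inside, not displayed
    (Wt : ℕ → ℕ → Fin (3 + 1) → (Fin (3 + 1) → ℤ) → Fin (3 + 1) → (Fin (3 + 1) → ℤ) → MKer (3 + 1) (Fib 3))
    (hWt1 : ∀ j, Wt j 1 = (JsB12Sym hOdd Ncol tabs cΛ cB j).W)
    -- (CONV-C) S-slot and W-slot rows of the UNDRESSED unit-rescaled jets of `JsB12Sym0` (row G-an2-4; HYPOTHESES; the dressing is bookkeeping,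
    -- `RoadEndLeftUndressed` §2)
    {Cs0 cS δS θS Cw0 cW δW θW : ℝ}
    (hS0 : ∀ j, LocStencil (unitS (sfStep Lc j) (smStep 3 Lc j) (JsB12Sym0 hOdd Ncol tabs cΛ cB j).S) Cs0 δS)
    (hSall0 : ∀ k j, LocStencil (unitS (sfStep Lc (k + j)) (smStep 3 Lc (k + j)) (JsB12Sym0 hOdd Ncol tabs cΛ cB (k + j)).S -
      unitS (sfStep Lc k) (smStep 3 Lc k) (JsB12Sym0 hOdd Ncol tabs cΛ cB k).S) (cS * θS ^ k) δS)
    (hW0 : ∀ j, VertexFamily₂ (unitW (sfStep Lc j) (smStep 3 Lc j) (JsB12Sym0 hOdd Ncol tabs cΛ cB j).W) Lc Cw0 δW)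
    (hWall0 : ∀ k j, VertexFamily₂ (unitW (sfStep Lc (k + j)) (smStep 3 Lc (k + j)) (JsB12Sym0 hOdd Ncol tabs cΛ cB (k + j)).W -
      unitW (sfStep Lc k) (smStep 3 Lc k) (JsB12Sym0 hOdd Ncol tabs cΛ cB k).W) Lc (cW * θW ^ k) δW)
    (hδS : 0 < δS) (hδW : 0 < δW) (hθS0 : 0 ≤ θS) (hθS1 : θS < 1) (hθW0 : 0 ≤ θW) (hθW1 : θW < 1)
    -- the BF comparison data: colour weights and the admissible families (PART 3b's list starts here)
    (wg wgh : ℝ)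
    {V : Fin 4 → Site 4 → MKer 4 (Fib 3)} {W : Fin 4 → Site 4 → Fin 4 → Site 4 → MKer 4 (Fib 3)} {Cv Cw Cx CwL cQ δ : ℝ} (hδ : 0 < δ)
    -- admissible-family letters, gluon sector — STRAIGHT: every letter at the leg `Pkerˢˢ := fun x z a b => Pker z x a b` (R-FP-42)
    (hV : ∀ (μ : Fin 4) (y : Site 4), BiLoc (V μ y) y y Cv δ) (hW : ∀ (μ : Fin 4) (y : Site 4) (ν : Fin 4) (y' : Site 4), BiLoc (W μ y ν y') y y' Cw δ)
    (hcovV : ∀ (μ : Fin 4) (y t : Site 4), V μ (y + t) = shiftK (-t) (V μ y))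
    (hcovW : ∀ (μ : Fin 4) (y : Site 4) (ν : Fin 4) (y' t : Site 4), W μ (y + t) ν (y' + t) = shiftK (-t) (W μ y ν y'))
    (X : Site 4 → MKer 4 (Fib 3)) (hX : ∀ y, BiLoc (X y) y y Cx δ)
    (hW1 : ∀ y, comp (comp (fun x z a b => Pker z x a b) (divV V y)) (fun x z a b => Pker z x a b)
      = comp (fun x z a b => Pker z x a b) (X y) - comp (X y) (fun x z a b => Pker z x a b))
    (hW2 : ∀ y ν y', divW W y ν y' = comp (X y) (V ν y') - comp (V ν y') (X y))
    -- (Kcov) of the STRAIGHT BF comparison kernel (= `PiBF` over the relabelled data, `LegShiftDictionary.PiBF_legShift`), ghost sector AT THE EXPLICIT PAIR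
    -- `(ghCur, diagExt (−ghX))` — DISPLAYED (gluon half: leaf-02's R13 `SliceKcovStraight` §3 shape; ghost half: leaf-01's `GhostBiTableReflection`)
    (hKcov : AxisReflectionCovariant (flipK (fun μ ν z => wg * hessKer (fun x z a b => Pker z x a b) V W μ ν z
      - wgh * hessKer G0ker ghCur (diagExt fun κ u => (-1 : ℝ) • ghX κ u) μ ν z)))
    (h0V : ∀ (lam α β : Fin 4), ∑' p : Pt × Pt, V lam 0 p.1 p.2 (Sum.inl α) (Sum.inl β) = 0)
    (hgermV : cubicGermOf V = cQ • bfGerm)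
    (hWloc : ∀ (μ ν : Fin 4) (z : Pt), BiLoc (W μ 0 ν z) 0 z (CwL * Real.exp (-δ * l1 z)) δ)
    -- (the ghost-sector letters `hv hw hcovv hcovw hXg hW1g hW2g h0v hgermv hwloc` are THEOREMS at `(ghCur, diagExt (−ghX), −projU)` —
    -- `GhostBiTableLaw` ∕ `GhostCubicGerm` ∕ `GhostGaugeLaw` — and are supplied INSIDE)
    -- the colour weights and the entry
    {N : ℝ} (hn : (40 * wg * (1 / 4 : ℝ) * (c4 * cQ) ^ 2 - wgh * (-(1 / 2 : ℝ)) * c4 ^ 2) / 3 = kappaBal N)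
    {μ ν : Fin 4} (hμν : μ ≠ ν)
    -- the X1m-S rows of `RoadLeftLiteralRows` (`hSm hSmall hθm hδsm hcov2`) are DISCHARGED at the S-family of record from `hS0 hSall0 hθS1 hδS`
    {Wf : ℕ → Fin (3 + 1) → (Fin (3 + 1) → ℤ) → Fin (3 + 1) → (Fin (3 + 1) → ℤ) → MKer (3 + 1) (Fib 3)}
    (hWf : ∀ m : ℕ, 1 ≤ m → ∃ C2 δ2 : ℝ, 0 < δ2 ∧ (∀ κ' u l' u', BiLoc (Wf m κ' u l' u') u u' C2 δ2) ∧
      ∀ κ' u l' u' t, Wf m κ' (u + ((Lc ^ m : ℕ) : ℤ) • t) l' (u' + ((Lc ^ m : ℕ) : ℤ) • t)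
        = shiftK (-(((Lc ^ m : ℕ) : ℤ) • t)) (Wf m κ' u l' u'))
    -- the FAR LETTER of the full fine kernel (m-free shape)
    {CF af : ℝ} (hCF : 0 ≤ CF) (haf : 0 < af)
    (hfar : ∀ m : ℕ, 1 ≤ m → ∀ (c e : Fin 4) (s s' : Pt), Lc ^ m < supNorm (s' - s) →
      |fineHessA (KPerf (d := 3) Lc (sfStep Lc) (smStep 3 Lc) m) (SPerfOf (sfStep Lc) (smStep 3 Lc) (fun j _ =>
        (JsB12Sym hOdd Ncol tabs cΛ cB j).S) m) (Wf m) c e s s'|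
        ≤ ((Lc ^ m : ℕ) : ℝ) ^ 8 * (CF / (supNorm (s' - s) : ℝ) ^ 6 * Real.exp (-(af / ((Lc ^ m : ℕ) : ℝ)) * (supNorm (s' - s) : ℝ))))
    -- THE DISPLAYED SLICE DATA per `m` — STRAIGHT (leg `c m • blk Pkerˢˢ tt + R m`): units and bubble weight, remainder leg, slice stencils∕bi-tables, `hslice`
    {c a b κ : ℕ → ℝ} (hunits₁ : ∀ m : ℕ, 1 ≤ m → (((Lc ^ m : ℕ) : ℝ) ^ 8) * wg = c m * b m)
    (hunits₂ : ∀ m : ℕ, 1 ≤ m → (((Lc ^ m : ℕ) : ℝ) ^ 8) * wg = κ m * (c m ^ 2 * a m ^ 2))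
    {R : ℕ → MKer 4 (Fin 4)} (hRb : ∀ m : ℕ, 1 ≤ m → ∃ CR, Bdd (R m) CR)
    {Ssl : ℕ → Fin 4 → Site 4 → MKer 4 (Fin 4)} (hSsl : ∀ m : ℕ, 1 ≤ m → ∃ Cs, ∀ κ u, BiLoc (Ssl m κ u) u u Cs δ)
    {Wsl : ℕ → Fin 4 → Site 4 → Fin 4 → Site 4 → MKer 4 (Fin 4)} (hWsl : ∀ m : ℕ, 1 ≤ m → ∃ C2, ∀ κ u l u', BiLoc (Wsl m κ u l u') u u' C2 δ)
    {Fmix Fgh FN : ℕ → EKer₂ 4}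
    (hslice : ∀ m : ℕ, 1 ≤ m → ∀ (c' e : Fin 4) (s s' : Pt),
      fineHessA (KPerf (d := 3) Lc (sfStep Lc) (smStep 3 Lc) m) (SPerfOf (sfStep Lc) (smStep 3 Lc) (fun j _ =>
        (JsB12Sym hOdd Ncol tabs cΛ cB j).S) m) (Wf m) c' e s s'
        = ((1 / 2 : ℝ) * tadpole (c m • blk (fun x z a b => Pker z x a b) true true + R m) (Wsl m c' s e s')
            - (1 / 2 : ℝ) * κ m * bubble (c m • blk (fun x z a b => Pker z x a b) true true + R m) (Ssl m c' s) (Ssl m e s'))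
          + Fmix m c' e s s' + Fgh m c' e s s' + FN m c' e s s')
    -- THE DISPLAYED MIX SPLIT (α2-a PART 2) and GHOST SPLIT (α2-c) into bounded pieces, and the normalisation piece's bound
    {ιM : Type*} (JM : Finset ιM) {Gmix : ιM → ℕ → EKer₂ 4}
    (hmix : ∀ m : ℕ, 1 ≤ m → ∀ (c' e : Fin 4) (s s' : Pt),
      (if supNorm (s' - s) ≤ Lc ^ m then Fmix m c' e s s' else 0) = ∑ k ∈ JM, Gmix k m c' e s s')
    (hGmix : ∀ k ∈ JM, ∀ m : ℕ, 1 ≤ m → ∀ c' e : Fin 4, ∃ A, ∀ s s', |Gmix k m c' e s s'| ≤ A)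
    {ιG : Type*} (JG : Finset ιG) {Ggh : ιG → ℕ → EKer₂ 4}
    (hgh : ∀ m : ℕ, 1 ≤ m → ∀ (c' e : Fin 4) (s s' : Pt),
      (if supNorm (s' - s) ≤ Lc ^ m then Fgh m c' e s s'
          + ((Lc ^ m : ℕ) : ℝ) ^ 8 * wgh * fineHessA G0ker ghCur (diagExt fun κ u => (-1 : ℝ) • ghX κ u) c' e s s' else 0)
        = ∑ k ∈ JG, Ggh k m c' e s s')
    (hGgh : ∀ k ∈ JG, ∀ m : ℕ, 1 ≤ m → ∀ c' e : Fin 4, ∃ A, ∀ s s', |Ggh k m c' e s s'| ≤ A)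
    (hFN : ∀ m : ℕ, 1 ≤ m → ∀ c' e : Fin 4, ∃ A, ∀ s s', |FN m c' e s s'| ≤ A)
    -- THE (rem) LEDGER: one number per named piece — the gluon-core words STRAIGHT (`Pkerˢˢ` for `Pker`)
    {B7 : Fin 7 → ℝ} {Bmix : ιM → ℝ} {Bgh : ιG → ℝ} {BN : ℝ}
    (hL0 : ∀ m : ℕ, 1 ≤ m → ∀ S' : Finset Pt, ∑ u ∈ S', (supNorm u : ℝ) ^ 2 *
      |dressedEntryP (fun c'' a' => colH (KPerf (d := 3) Lc (sfStep Lc) (smStep 3 Lc) m) (Lc ^ m) a' 0 c'')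
        (fun c' e s s' => if supNorm (s' - s) ≤ Lc ^ m then (1 / 2 : ℝ) * tadpole (R m) (Wsl m c' s e s') else 0)
        (((Lc ^ m : ℕ) : ℤ) • (-u)) μ ν| ≤ B7 0)
    (hL1 : ∀ m : ℕ, 1 ≤ m → ∀ S' : Finset Pt, ∑ u ∈ S', (supNorm u : ℝ) ^ 2 *
      |dressedEntryP (fun c'' a' => colH (KPerf (d := 3) Lc (sfStep Lc) (smStep 3 Lc) m) (Lc ^ m) a' 0 c'')
        (fun c' e s s' => if supNorm (s' - s) ≤ Lc ^ m then
          -((1 / 2 : ℝ) * κ m) * tr (comp (comp (c m • blk (fun x z a b => Pker z x a b) true true) (Ssl m c' s)) (comp (R m) (Ssl m e s'))) else 0)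
        (((Lc ^ m : ℕ) : ℤ) • (-u)) μ ν| ≤ B7 1)
    (hL2 : ∀ m : ℕ, 1 ≤ m → ∀ S' : Finset Pt, ∑ u ∈ S', (supNorm u : ℝ) ^ 2 *
      |dressedEntryP (fun c'' a' => colH (KPerf (d := 3) Lc (sfStep Lc) (smStep 3 Lc) m) (Lc ^ m) a' 0 c'')
        (fun c' e s s' => if supNorm (s' - s) ≤ Lc ^ m then
          -((1 / 2 : ℝ) * κ m) * tr (comp (comp (R m) (Ssl m c' s)) (comp (c m • blk (fun x z a b => Pker z x a b) true true) (Ssl m e s'))) else 0)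
        (((Lc ^ m : ℕ) : ℤ) • (-u)) μ ν| ≤ B7 2)
    (hL3 : ∀ m : ℕ, 1 ≤ m → ∀ S' : Finset Pt, ∑ u ∈ S', (supNorm u : ℝ) ^ 2 *
      |dressedEntryP (fun c'' a' => colH (KPerf (d := 3) Lc (sfStep Lc) (smStep 3 Lc) m) (Lc ^ m) a' 0 c'')
        (fun c' e s s' => if supNorm (s' - s) ≤ Lc ^ m then -((1 / 2 : ℝ) * κ m) * bubble (R m) (Ssl m c' s) (Ssl m e s') else 0)
        (((Lc ^ m : ℕ) : ℤ) • (-u)) μ ν| ≤ B7 3)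
    (hL4 : ∀ m : ℕ, 1 ≤ m → ∀ S' : Finset Pt, ∑ u ∈ S', (supNorm u : ℝ) ^ 2 *
      |dressedEntryP (fun c'' a' => colH (KPerf (d := 3) Lc (sfStep Lc) (smStep 3 Lc) m) (Lc ^ m) a' 0 c'')
        (fun c' e s s' => if supNorm (s' - s) ≤ Lc ^ m then
          (1 / 2 : ℝ) * tadpole (c m • blk (fun x z a b => Pker z x a b) true true) (Wsl m c' s e s' - b m • blk (W c' s e s') true true) else 0)
        (((Lc ^ m : ℕ) : ℤ) • (-u)) μ ν| ≤ B7 4)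
    (hL5 : ∀ m : ℕ, 1 ≤ m → ∀ S' : Finset Pt, ∑ u ∈ S', (supNorm u : ℝ) ^ 2 *
      |dressedEntryP (fun c'' a' => colH (KPerf (d := 3) Lc (sfStep Lc) (smStep 3 Lc) m) (Lc ^ m) a' 0 c'')
        (fun c' e s s' => if supNorm (s' - s) ≤ Lc ^ m then
          -((1 / 2 : ℝ) * κ m) * bubble (c m • blk (fun x z a b => Pker z x a b) true true) (Ssl m c' s - a m • blk (V c' s) true true) (Ssl m e s') else 0)
        (((Lc ^ m : ℕ) : ℤ) • (-u)) μ ν| ≤ B7 5)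
    (hL6 : ∀ m : ℕ, 1 ≤ m → ∀ S' : Finset Pt, ∑ u ∈ S', (supNorm u : ℝ) ^ 2 *
      |dressedEntryP (fun c'' a' => colH (KPerf (d := 3) Lc (sfStep Lc) (smStep 3 Lc) m) (Lc ^ m) a' 0 c'')
        (fun c' e s s' => if supNorm (s' - s) ≤ Lc ^ m then
          -((1 / 2 : ℝ) * κ m) * bubble (c m • blk (fun x z a b => Pker z x a b) true true) (a m • blk (V c' s) true true) (Ssl m e s' - a m • blk
            (V e s') true true) else 0)
        (((Lc ^ m : ℕ) : ℤ) • (-u)) μ ν| ≤ B7 6)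
    (hLmix : ∀ k ∈ JM, ∀ m : ℕ, 1 ≤ m → ∀ S' : Finset Pt, ∑ u ∈ S', (supNorm u : ℝ) ^ 2 *
      |dressedEntryP (fun c'' a' => colH (KPerf (d := 3) Lc (sfStep Lc) (smStep 3 Lc) m) (Lc ^ m) a' 0 c'') (Gmix k m)
        (((Lc ^ m : ℕ) : ℤ) • (-u)) μ ν| ≤ Bmix k)
    (hLgh : ∀ k ∈ JG, ∀ m : ℕ, 1 ≤ m → ∀ S' : Finset Pt, ∑ u ∈ S', (supNorm u : ℝ) ^ 2 *
      |dressedEntryP (fun c'' a' => colH (KPerf (d := 3) Lc (sfStep Lc) (smStep 3 Lc) m) (Lc ^ m) a' 0 c'') (Ggh k m)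
        (((Lc ^ m : ℕ) : ℤ) • (-u)) μ ν| ≤ Bgh k)
    (hLN : ∀ m : ℕ, 1 ≤ m → ∀ S' : Finset Pt, ∑ u ∈ S', (supNorm u : ℝ) ^ 2 *
      |dressedEntryP (fun c'' a' => colH (KPerf (d := 3) Lc (sfStep Lc) (smStep 3 Lc) m) (Lc ^ m) a' 0 c'')
        (fun c' e s s' => if supNorm (s' - s) ≤ Lc ^ m then FN m c' e s s' else 0)
        (((Lc ^ m : ℕ) : ℤ) • (-u)) μ ν| ≤ BN)
    -- THE STEP DOOR AND THE SYMMETRY DOOR, OPENED DOWN TO FINITE-`j` ROWS (R-FP-40 (C)): the WARD and TRANSPOSITION laws of the wall's own kernels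
    -- `TbalOf Lc Js j` at EVERY `j`, and (SDF) — NO X1m-W row of the FULL (j, m)-tables (the full slot's class data follows from the W-split, §1)
    (hWj : ∀ j, WardTransversal (flipK (TbalOf Lc (JsB12Sym hOdd Ncol tabs cΛ cB) j)))
    -- `hTj` (the transposition law of `TbalOf Lc (JsB12Sym …) j`) is leaf-01's THEOREM `RoadLeftLiteralSwap.hTj_JsB12Sym` — DISCHARGED inside
    (hSDF : ∀ m : ℕ, 1 ≤ m → B12Beta.secondMoment (defect
      (fun m => hessKer (KPerf (d := 3) Lc (sfStep Lc) (smStep 3 Lc) m)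
        (vertexOfK (KPerf (d := 3) Lc (sfStep Lc) (smStep 3 Lc) m) (Lc ^ m) (SPerfOf (sfStep Lc) (smStep 3 Lc) (fun j _ =>
          (JsB12Sym hOdd Ncol tabs cΛ cB j).S) m)) (WPerfOf (sfStep Lc) (smStep 3 Lc) Wt m))
      (fun m a b z => ((Lc ^ m : ℕ) : ℝ) ^ 8 * dressedEntry (colOf (KPerf (d := 3) Lc (sfStep Lc) (smStep 3 Lc) m))
        (hessKer (KPerf (d := 3) Lc (sfStep Lc) (smStep 3 Lc) 1)
          (vertexOfK (KPerf (d := 3) Lc (sfStep Lc) (smStep 3 Lc) 1) Lc (SPerfOf (sfStep Lc) (smStep 3 Lc) (fun j _ =>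
            (JsB12Sym hOdd Ncol tabs cΛ cB j).S) 1)) (WPerfOf (sfStep Lc) (smStep 3 Lc) Wt 1))
        (((Lc ^ m : ℕ) : ℤ) • z) a b) m) μ ν = 0)
    -- the W-slot split of the perfect second-order slot (row #14): the split, ONE `VertexFamily₂` letter of the EXTRA slot `Wx m`, and the extra piece's
    -- bound ((G8)∕(G-mix-W)); `hloc₀`∕`hs₀` (bi-vertex slot) and `hlocx`∕`hsx` (extra slot) are supplied inside (`BiVertexSlotLetters` §4)
    {Wx : ℕ → Fin (3 + 1) → (Fin (3 + 1) → ℤ) → Fin (3 + 1) → (Fin (3 + 1) → ℤ) → MKer (3 + 1) (Fib 3)}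
    (hsplit : ∀ m : ℕ, 1 ≤ m →
      WPerfOf (sfStep Lc) (smStep 3 Lc) Wt m = vertex2OfK (KPerf (d := 3) Lc (sfStep Lc) (smStep 3 Lc) m) (Lc ^ m) (Wf m) + Wx m)
    (hWx : ∀ m : ℕ, 1 ≤ m → ∃ Cx δx : ℝ, 0 < δx ∧ VertexFamily₂ (Wx m) (Lc ^ m) Cx δx)
    {B : ℝ}
    (hextra : ∀ m : ℕ, 1 ≤ m →
      |B12Beta.secondMoment
          (fun μ' ν' z => (1 / 2 : ℝ) * tadpole (KPerf (d := 3) Lc (sfStep Lc) (smStep 3 Lc) m) (Wx m μ' 0 ν' z)) μ ν| ≤ B) :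
    D1Drift Lc (JsB12Sym hOdd Ncol tabs cΛ cB) N μ ν := by
  obtain ⟨Ψ, hr, hr', hs⟩ := exists_legShift
  obtain ⟨Ψ', hr₄, hs₄⟩ := exists_legShift₄
  -- the gluon block transported along `Ψ` (`LegShiftDictionary`)
  have hV' : ∀ (μ : Fin 4) (y : Site 4), BiLoc (refK Ψ (V μ y)) y y (Cv * Real.exp (2 * δ)) δ :=
    fun μ y => biLoc_refK_legShift Ψ hr hr' hs hδ.le (hV μ y)
  have hW' : ∀ (μ : Fin 4) (y : Site 4) (ν : Fin 4) (y' : Site 4), BiLoc (refK Ψ (W μ y ν y')) y y' (Cw * Real.exp (2 * δ)) δ :=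
    fun μ y ν y' => biLoc_refK_legShift Ψ hr hr' hs hδ.le (hW μ y ν y')
  have hX' : ∀ y : Site 4, BiLoc (refK Ψ (X y)) y y (Cx * Real.exp (2 * δ)) δ :=
    fun y => biLoc_refK_legShift Ψ hr hr' hs hδ.le (hX y)
  have hWloc' : ∀ (μ ν : Fin 4) (z : Pt), BiLoc (refK Ψ (W μ 0 ν z)) 0 z (CwL * Real.exp (2 * δ) * Real.exp (-δ * l1 z)) δ := by
    intro μ ν z
    have h := biLoc_refK_legShift Ψ hr hr' hs hδ.le (hWloc μ ν z)
    rw [mul_right_comm CwL] at h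
    exact h
  have hgermV' : cubicGermOf (fun lam y => refK Ψ (V lam y)) = cQ • bfGerm := (cubicGermOf_legShift_of_h0 Ψ hr hs hδ hV h0V).trans hgermV
  have ePi : PiBF wg wgh (fun μ y => refK Ψ (V μ y)) (fun μ y ν y' => refK Ψ (W μ y ν y')) ghCur (diagExt fun κ u => (-1 : ℝ) • ghX κ u)
      = fun μ ν z => wg * hessKer (fun x z a b => Pker z x a b) V W μ ν z - wgh * hessKer G0ker ghCur (diagExt fun κ u => (-1 : ℝ) • ghX κ u) μ ν z :=
    funext fun μ => funext fun ν => funext fun z => PiBF_legShift Ψ hr hs wg wgh hδ hV hW _ _ μ ν z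
  have hKcov' : AxisReflectionCovariant (flipK (PiBF wg wgh (fun μ y => refK Ψ (V μ y)) (fun μ y ν y' => refK Ψ (W μ y ν y')) ghCur
      (diagExt fun κ u => (-1 : ℝ) • ghX κ u))) := by
    rw [ePi]; exact hKcov
  -- the slice∕ledger block transported along `Ψ'` (`LegShiftDictionaryBlocks`): the straight words and the END's words agree pointwise
  have hPss : Bdd (blk (fun x z a b => Pker z x a b) true true) A0P := bdd_blk bdd_PkerSwap true true
  have eP : ∀ c' : ℝ, c' • blk Pker true true = refK Ψ' (c' • blk (fun x z a b => Pker z x a b) true true) := fun c' => by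
    rw [refK_smul, refK_legShift₄_blk_PkerSwap Ψ' hr₄ hs₄]
  have eV : ∀ (a' : ℝ) (κ : Fin 4) (u : Site 4), a' • blk (refK Ψ (V κ u)) true true = refK Ψ' (a' • blk (V κ u) true true) := fun a' κ u => by
    rw [refK_smul, blk_tt_refK Ψ' hr₄ hs₄ Ψ hr hs]
  have hRb' : ∀ m : ℕ, 1 ≤ m → ∃ CR, Bdd (refK Ψ' (R m)) CR := fun m hm => (hRb m hm).imp fun CR h => bdd_refK Ψ' h
  have hSsl' : ∀ m : ℕ, 1 ≤ m → ∃ Cs, ∀ κ u, BiLoc (refK Ψ' (Ssl m κ u)) u u Cs δ := fun m hm => by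
    obtain ⟨Cs, h⟩ := hSsl m hm
    exact ⟨Cs * Real.exp (2 * δ), fun κ u => biLoc_refK_legShift₄ Ψ' hr₄ hs₄ hδ.le (h κ u)⟩
  have hWsl' : ∀ m : ℕ, 1 ≤ m → ∃ C2, ∀ κ u l u', BiLoc (refK Ψ' (Wsl m κ u l u')) u u' C2 δ := fun m hm => by
    obtain ⟨C2, h⟩ := hWsl m hm
    exact ⟨C2 * Real.exp (2 * δ), fun κ u l u' => biLoc_refK_legShift₄ Ψ' hr₄ hs₄ hδ.le (h κ u l u')⟩
  have hslice' : ∀ m : ℕ, 1 ≤ m → ∀ (c' e : Fin 4) (s s' : Pt),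
      fineHessA (KPerf (d := 3) Lc (sfStep Lc) (smStep 3 Lc) m) (SPerfOf (sfStep Lc) (smStep 3 Lc) (fun j _ => (JsB12Sym hOdd Ncol tabs cΛ cB j).S) m) (Wf m) c' e s s'
      = ((1 / 2 : ℝ) * tadpole (c m • blk Pker true true + refK Ψ' (R m)) (refK Ψ' (Wsl m c' s e s'))
      - (1 / 2 : ℝ) * κ m * bubble (c m • blk Pker true true + refK Ψ' (R m)) (refK Ψ' (Ssl m c' s)) (refK Ψ' (Ssl m e s')))
      + Fmix m c' e s s' + Fgh m c' e s s' + FN m c' e s s' := by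
    intro m hm c' e s s'
    obtain ⟨CR, hR⟩ := hRb m hm
    obtain ⟨Cs, hS⟩ := hSsl m hm
    obtain ⟨C2, hW2⟩ := hWsl m hm
    have hA := bdd_smul_add (c m) hPss hR
    rw [sliceLeg_legShift₄ Ψ' hr₄ hs₄ (c m) (R m), tadpole_refK_bdd Ψ' hA (hW2 c' s e s') hδ, bubble_refK_bdd Ψ' hA (hS c' s) (hS e s') hδ]
    exact hslice m hm c' e s s'
  have hL0' : ∀ m : ℕ, 1 ≤ m → ∀ S' : Finset Pt, ∑ u ∈ S', (supNorm u : ℝ) ^ 2 *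
      |dressedEntryP (fun c'' a' => colH (KPerf (d := 3) Lc (sfStep Lc) (smStep 3 Lc) m) (Lc ^ m) a' 0 c'')
      (fun c' e s s' => if supNorm (s' - s) ≤ Lc ^ m then (1 / 2 : ℝ) * tadpole (refK Ψ' (R m)) (refK Ψ' (Wsl m c' s e s')) else 0)
      (((Lc ^ m : ℕ) : ℤ) • (-u)) μ ν| ≤ B7 0 := by
    intro m hm S'
    obtain ⟨CR, hR⟩ := hRb m hm
    obtain ⟨C2, hW2⟩ := hWsl m hm
    have t : ∀ (c' : Fin 4) (s : Pt) (e : Fin 4) (s' : Pt), tadpole (refK Ψ' (R m)) (refK Ψ' (Wsl m c' s e s')) = tadpole (R m) (Wsl m c' s e s') :=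
      fun c' s e s' => tadpole_refK_bdd Ψ' hR (hW2 c' s e s') hδ
    simp only [t]
    exact hL0 m hm S'
  have hL1' : ∀ m : ℕ, 1 ≤ m → ∀ S' : Finset Pt, ∑ u ∈ S', (supNorm u : ℝ) ^ 2 *
      |dressedEntryP (fun c'' a' => colH (KPerf (d := 3) Lc (sfStep Lc) (smStep 3 Lc) m) (Lc ^ m) a' 0 c'')
      (fun c' e s s' => if supNorm (s' - s) ≤ Lc ^ m then
      -((1 / 2 : ℝ) * κ m) * tr (comp (comp (c m • blk Pker true true) (refK Ψ' (Ssl m c' s))) (comp (refK Ψ' (R m)) (refK Ψ' (Ssl m e s')))) else 0)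
      (((Lc ^ m : ℕ) : ℤ) • (-u)) μ ν| ≤ B7 1 := by
    intro m hm S'
    obtain ⟨CR, hR⟩ := hRb m hm
    obtain ⟨Cs, hS⟩ := hSsl m hm
    have t : ∀ (c' : Fin 4) (s : Pt) (e : Fin 4) (s' : Pt),
        tr (comp (comp (c m • blk Pker true true) (refK Ψ' (Ssl m c' s))) (comp (refK Ψ' (R m)) (refK Ψ' (Ssl m e s'))))
          = tr (comp (comp (c m • blk (fun x z a b => Pker z x a b) true true) (Ssl m c' s)) (comp (R m) (Ssl m e s'))) := fun c' s e s' => by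
      rw [eP (c m)]; exact mixedBubble_refK_bdd Ψ' (bdd_smul hPss (c m)) hR (hS c' s) (hS e s') hδ
    simp only [t]
    exact hL1 m hm S'
  have hL2' : ∀ m : ℕ, 1 ≤ m → ∀ S' : Finset Pt, ∑ u ∈ S', (supNorm u : ℝ) ^ 2 *
      |dressedEntryP (fun c'' a' => colH (KPerf (d := 3) Lc (sfStep Lc) (smStep 3 Lc) m) (Lc ^ m) a' 0 c'')
      (fun c' e s s' => if supNorm (s' - s) ≤ Lc ^ m then
      -((1 / 2 : ℝ) * κ m) * tr (comp (comp (refK Ψ' (R m)) (refK Ψ' (Ssl m c' s))) (comp (c m • blk Pker true true) (refK Ψ' (Ssl m e s')))) else 0)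
      (((Lc ^ m : ℕ) : ℤ) • (-u)) μ ν| ≤ B7 2 := by
    intro m hm S'
    obtain ⟨CR, hR⟩ := hRb m hm
    obtain ⟨Cs, hS⟩ := hSsl m hm
    have t : ∀ (c' : Fin 4) (s : Pt) (e : Fin 4) (s' : Pt),
        tr (comp (comp (refK Ψ' (R m)) (refK Ψ' (Ssl m c' s))) (comp (c m • blk Pker true true) (refK Ψ' (Ssl m e s'))))
          = tr (comp (comp (R m) (Ssl m c' s)) (comp (c m • blk (fun x z a b => Pker z x a b) true true) (Ssl m e s'))) := fun c' s e s' => by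
      rw [eP (c m)]; exact mixedBubble_refK_bdd Ψ' hR (bdd_smul hPss (c m)) (hS c' s) (hS e s') hδ
    simp only [t]
    exact hL2 m hm S'
  have hL3' : ∀ m : ℕ, 1 ≤ m → ∀ S' : Finset Pt, ∑ u ∈ S', (supNorm u : ℝ) ^ 2 *
      |dressedEntryP (fun c'' a' => colH (KPerf (d := 3) Lc (sfStep Lc) (smStep 3 Lc) m) (Lc ^ m) a' 0 c'')
      (fun c' e s s' => if supNorm (s' - s) ≤ Lc ^ m then -((1 / 2 : ℝ) * κ m) * bubble (refK Ψ' (R m)) (refK Ψ' (Ssl m c' s)) (refK Ψ' (Ssl m e s')) else 0)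
      (((Lc ^ m : ℕ) : ℤ) • (-u)) μ ν| ≤ B7 3 := by
    intro m hm S'
    obtain ⟨CR, hR⟩ := hRb m hm
    obtain ⟨Cs, hS⟩ := hSsl m hm
    have t : ∀ (c' : Fin 4) (s : Pt) (e : Fin 4) (s' : Pt),
        bubble (refK Ψ' (R m)) (refK Ψ' (Ssl m c' s)) (refK Ψ' (Ssl m e s')) = bubble (R m) (Ssl m c' s) (Ssl m e s') :=
      fun c' s e s' => bubble_refK_bdd Ψ' hR (hS c' s) (hS e s') hδ
    simp only [t]
    exact hL3 m hm S'
  have hL4' : ∀ m : ℕ, 1 ≤ m → ∀ S' : Finset Pt, ∑ u ∈ S', (supNorm u : ℝ) ^ 2 *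
      |dressedEntryP (fun c'' a' => colH (KPerf (d := 3) Lc (sfStep Lc) (smStep 3 Lc) m) (Lc ^ m) a' 0 c'')
      (fun c' e s s' => if supNorm (s' - s) ≤ Lc ^ m then
      (1 / 2 : ℝ) * tadpole (c m • blk Pker true true) (refK Ψ' (Wsl m c' s e s') - b m • blk (refK Ψ (W c' s e s')) true true) else 0)
      (((Lc ^ m : ℕ) : ℤ) • (-u)) μ ν| ≤ B7 4 := by
    intro m hm S'
    obtain ⟨C2, hW2⟩ := hWsl m hm
    have t : ∀ (c' : Fin 4) (s : Pt) (e : Fin 4) (s' : Pt),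
        tadpole (c m • blk Pker true true) (refK Ψ' (Wsl m c' s e s') - b m • blk (refK Ψ (W c' s e s')) true true)
          = tadpole (c m • blk (fun x z a b => Pker z x a b) true true) (Wsl m c' s e s' - b m • blk (W c' s e s') true true) := fun c' s e s' => by
      rw [eP (c m), defectJet_legShift₄ Ψ' hr₄ hs₄ Ψ hr hs (b m) (Wsl m c' s e s') (W c' s e s')]
      exact tadpole_refK_bdd Ψ' (bdd_smul hPss (c m)) (biLoc_sub (hW2 c' s e s') (biLoc_smul (biLoc_blk (hW c' s e s') true true) (b m))) hδ
    simp only [t]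
    exact hL4 m hm S'
  have hL5' : ∀ m : ℕ, 1 ≤ m → ∀ S' : Finset Pt, ∑ u ∈ S', (supNorm u : ℝ) ^ 2 *
      |dressedEntryP (fun c'' a' => colH (KPerf (d := 3) Lc (sfStep Lc) (smStep 3 Lc) m) (Lc ^ m) a' 0 c'')
      (fun c' e s s' => if supNorm (s' - s) ≤ Lc ^ m then
      -((1 / 2 : ℝ) * κ m) * bubble (c m • blk Pker true true) (refK Ψ' (Ssl m c' s) - a m • blk (refK Ψ (V c' s)) true true) (refK Ψ' (Ssl m e s')) else 0)
      (((Lc ^ m : ℕ) : ℤ) • (-u)) μ ν| ≤ B7 5 := by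
    intro m hm S'
    obtain ⟨Cs, hS⟩ := hSsl m hm
    have t : ∀ (c' : Fin 4) (s : Pt) (e : Fin 4) (s' : Pt),
        bubble (c m • blk Pker true true) (refK Ψ' (Ssl m c' s) - a m • blk (refK Ψ (V c' s)) true true) (refK Ψ' (Ssl m e s'))
          = bubble (c m • blk (fun x z a b => Pker z x a b) true true) (Ssl m c' s - a m • blk (V c' s) true true) (Ssl m e s') := fun c' s e s' => by
      rw [eP (c m), defectJet_legShift₄ Ψ' hr₄ hs₄ Ψ hr hs (a m) (Ssl m c' s) (V c' s)]
      exact bubble_refK_bdd Ψ' (bdd_smul hPss (c m)) (biLoc_sub (hS c' s) (biLoc_smul (biLoc_blk (hV c' s) true true) (a m))) (hS e s') hδ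
    simp only [t]
    exact hL5 m hm S'
  have hL6' : ∀ m : ℕ, 1 ≤ m → ∀ S' : Finset Pt, ∑ u ∈ S', (supNorm u : ℝ) ^ 2 *
      |dressedEntryP (fun c'' a' => colH (KPerf (d := 3) Lc (sfStep Lc) (smStep 3 Lc) m) (Lc ^ m) a' 0 c'')
      (fun c' e s s' => if supNorm (s' - s) ≤ Lc ^ m then
      -((1 / 2 : ℝ) * κ m) * bubble (c m • blk Pker true true) (a m • blk (refK Ψ (V c' s)) true true) (refK Ψ' (Ssl m e s') - a m • blk (refK Ψ (V e s')) true true) else 0)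
      (((Lc ^ m : ℕ) : ℤ) • (-u)) μ ν| ≤ B7 6 := by
    intro m hm S'
    obtain ⟨Cs, hS⟩ := hSsl m hm
    have t : ∀ (c' : Fin 4) (s : Pt) (e : Fin 4) (s' : Pt),
        bubble (c m • blk Pker true true) (a m • blk (refK Ψ (V c' s)) true true) (refK Ψ' (Ssl m e s') - a m • blk (refK Ψ (V e s')) true true)
          = bubble (c m • blk (fun x z a b => Pker z x a b) true true) (a m • blk (V c' s) true true) (Ssl m e s' - a m • blk (V e s') true true) := fun c' s e s' => by
      rw [eP (c m), defectJet_legShift₄ Ψ' hr₄ hs₄ Ψ hr hs (a m) (Ssl m e s') (V e s'), eV (a m) c' s]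
      exact bubble_refK_bdd Ψ' (bdd_smul hPss (c m)) (biLoc_smul (biLoc_blk (hV c' s) true true) (a m))
        (biLoc_sub (hS e s') (biLoc_smul (biLoc_blk (hV e s') true true) (a m))) hδ
    simp only [t]
    exact hL6 m hm S'
  exact d1Drift_JsB12Sym_of_sliceLedger_ghost_Srec
    (V := fun μ y => refK Ψ (V μ y)) (W := fun μ y ν y' => refK Ψ (W μ y ν y')) (R := fun m => refK Ψ' (R m))
    (Ssl := fun m κ u => refK Ψ' (Ssl m κ u)) (Wsl := fun m κ u l u' => refK Ψ' (Wsl m κ u l u'))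
    hLc hOdd Ncol tabs cΛ cB Wt hWt1 hS0 hSall0 hW0 hWall0 hδS hδW hθS0 hθS1 hθW0 hθW1 wg wgh hδ hV' hW' (cov_refK_legShift Ψ hr hr' hcovV)
    (cov₂_refK_legShift Ψ hr hr' hcovW) (fun y => refK Ψ (X y)) hX' (hW1_legShift Ψ hr hs hδ hV hX hW1) (hW2_legShift Ψ hδ hV hX hW2) hKcov' (h0V_legShift
    Ψ hr hs h0V) hgermV' hWloc' hn hμν hWf hCF haf hfar hunits₁ hunits₂ hRb' hSsl' hWsl' hslice' JM hmix hGmix JG hgh hGgh hFN hL0' hL1' hL2' hL3' hL4'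
    hL5' hL6' hLmix hLgh hLN hWj hSDF hsplit hWx hextra

end Summit.QuantumFields.BalabanUV.Beta.FP.RoadLeftLiteralStraight

end
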